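import Mathlib.Analysis.SpecialFunctions.Trigonometric.Sinc
import Mathlib.Analysis.SpecialFunctions.Integrals.Basic
import Summits.AnomalousDissipation.AnomalousDissipation.Theorems.SawtoothPulseCascadeK1LocalisedCascadeAxisBlock

/-!
# K1loc, line `Spectral` — S-D (thin start): STRIP ENERGY IS CONTROLLED BY WINDOWED AXIS AVERAGES

Helper file of the prover lane on the crux `K1LocalisedCascade` (stmt-AnomalousDissipation-19491), route
`SawtoothPulseCascade` (glue seat k1loc-p3; S-B ↔ S-D hand-over).  With the thin-start closer
(`…K1Ledger.From.k1Localised_of_thin_iterate_bound`) the tracked set of the ledger at the hand-over phase contains the whole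
horizontal STRIP `{k : |kᵢ| ≤ L}` with `L = 1.004·c(γ²−3)^n` columns, so per-column amplitude bounds cannot be summed.  The
remedy is a LOCAL version of the column estimate: the box window of half-width `h = 1/(4L)` along the `i`-th axis,
`W_h v(x) = ∫_{−h}^{h} v(x + u eᵢ) du`, has the torus multiplier `2h·sinc(2πkᵢh)` (`mFourierCoeff_windowAvg`), and
`sinc ≥ 2/π` on `[−π/2, π/2]` (Jordan), so on the strip `|kᵢ| ≤ L` the multiplier is `≥ 1/(πL)`; Parseval then gives
**`Σ' k, [|kᵢ| ≤ L]·‖𝓕v(k)‖² ≤ (πL)²·∫ ‖W_{1/(4L)} v(x)‖² dx`** (`tsum_strip_le_windowAvg`; i.e. `(π²/4)·‖local average‖²`),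
UNIFORMLY IN THE NUMBER OF COLUMNS, and `≤ (πL)²∫ g²` for any continuous pointwise majorant `g` of `|W_h θ|`
(`tsum_strip_real_le_of_windowAvg_le`; also for weights `0 ≤ w ≤ [|kᵢ| ≤ L]`, e.g. the square of the ledger's start symbol on
the strip).  The S-D lane bounds `|∫_{−h}^{h} θ(x + ueᵢ)du|` for the inviscid iterate as it bounds the full chord
(`…ChordSum`, `…OscillatoryChord` at `m = 0`), but over windows of length `1/(2L)`: cells meeting the window contribute
`1/(π|k_c|)` each (all released cells have `|k_c| ≥ K₀L`), the bad set its local measure.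
WHAT THIS IS NOT: no statement about the cascade. [cite: Grafakos2014, Prop. 3.1.2 (5) and Prop. 3.2.7 (3)] [problem: turb]
-/

-- `Summit.<Summit>.<Problem>`: single-conjunct summit, the duplicate namespace segment is deliberate.
set_option linter.dupNamespace false

noncomputable section

namespace Summit.AnomalousDissipation.AnomalousDissipation.Theorems.SawtoothPulseCascade.K1Start

open MeasureTheory Set Filter Topology UnitAddTorus Function
open Literature.Analysis.FunctionSpaces Literature.Analysis.FunctionSpaces.Torus

variable {d : Type*} [Fintype d] [DecidableEq d]

/-! ## §1 The window multiplier and Jordan's inequality -/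

omit [Fintype d] [DecidableEq d] in
/-- `∫_{−h}^{h} e_n(u) du = 2h·sinc(2πnh)` on the unit circle (`h > 0`). [cite: Grafakos2014, Prop. 3.1.2 (5)] -/
theorem intervalIntegral_fourier_coe (n : ℤ) {h : ℝ} (hh : 0 < h) :
    ∫ u in (-h)..h, (fourier n (u : UnitAddCircle) : ℂ) = ((2 * h * Real.sinc (2 * Real.pi * n * h) : ℝ) : ℂ) := by
  have hfun : (fun u : ℝ => (fourier n (u : UnitAddCircle) : ℂ)) =
      fun u : ℝ => Complex.exp (2 * Real.pi * Complex.I * n * u) := by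
    funext u
    rw [fourier_coe_apply]
    simp
  rw [hfun]
  by_cases hn : n = 0
  · subst hn
    simp [two_mul]
  · have hπ : (Real.pi : ℂ) ≠ 0 := Complex.ofReal_ne_zero.mpr Real.pi_ne_zero
    have hn' : (n : ℂ) ≠ 0 := Int.cast_ne_zero.mpr hn
    have hh' : (h : ℂ) ≠ 0 := Complex.ofReal_ne_zero.mpr hh.ne'
    have hc : (2 * Real.pi * Complex.I * n : ℂ) ≠ 0 := by simp [hπ, hn', Complex.I_ne_zero]
    have hα : (2 * Real.pi * n * h : ℝ) ≠ 0 := by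
      have : (n : ℝ) ≠ 0 := Int.cast_ne_zero.mpr hn
      positivity
    rw [integral_exp_mul_complex hc, Real.sinc_of_ne_zero hα]
    have e1 : (2 * Real.pi * Complex.I * n : ℂ) * (h : ℝ) = ((2 * Real.pi * n * h : ℝ) : ℂ) * Complex.I := by
      push_cast; ring
    have e2 : (2 * Real.pi * Complex.I * n : ℂ) * ((-h : ℝ) : ℂ) = (-((2 * Real.pi * n * h : ℝ) : ℂ)) * Complex.I := by
      push_cast; ring
    rw [e1, e2, Complex.exp_mul_I, Complex.exp_mul_I, Complex.cos_neg, Complex.sin_neg]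
    rw [← Complex.ofReal_cos, ← Complex.ofReal_sin]
    push_cast
    field_simp
    ring

omit [Fintype d] [DecidableEq d] in
/-- **Jordan's inequality for `sinc`**: `2/π ≤ sinc x` for `|x| ≤ π/2`. [folklore] -/
theorem two_div_pi_le_sinc {x : ℝ} (hx : |x| ≤ Real.pi / 2) : 2 / Real.pi ≤ Real.sinc x := by
  wlog h0 : 0 ≤ x generalizing x
  · have h := this (x := -x) (by rwa [abs_neg]) (by linarith)
    rwa [Real.sinc_neg] at h
  rcases h0.eq_or_lt with h00 | hpos
  · rw [← h00, Real.sinc_zero, div_le_one Real.pi_pos]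
    exact Real.two_le_pi
  · rw [Real.sinc_of_ne_zero hpos.ne', le_div_iff₀ hpos]
    exact Real.mul_le_sin h0 (abs_le.mp hx).2

/-! ## §2 The windowed axis average and its multiplier -/

omit [Fintype d] in
/-- The windowed axis average of a continuous field is continuous. [folklore] -/
theorem continuous_windowAvg {v : UnitAddTorus d → ℂ} (hv : Continuous v) (i : d) (a b : ℝ) :
    Continuous fun x : UnitAddTorus d => ∫ u in a..b, v (x + Pi.single i ((u : ℝ) : UnitAddCircle)) := by
  have hF : Continuous (uncurry fun (x : UnitAddTorus d) (u : ℝ) => v (x + Pi.single i ((u : ℝ) : UnitAddCircle))) := by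
    refine hv.comp ?_
    exact continuous_fst.add ((continuous_single i).comp ((AddCircle.continuous_mk' (1 : ℝ)).comp continuous_snd))
  exact intervalIntegral.continuous_parametric_intervalIntegral_of_continuous' hF a b

/-- **The multiplier of the window**: `𝓕(x ↦ ∫_{−h}^{h} v(x + ueᵢ)du)(k) = 2h·sinc(2πkᵢh)·𝓕v(k)` (`v` continuous, `h > 0`).
[cite: Grafakos2014, Prop. 3.1.2 (5)] -/
theorem mFourierCoeff_windowAvg {v : UnitAddTorus d → ℂ} (hv : Continuous v) (i : d) {h : ℝ} (hh : 0 < h)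
    (k : d → ℤ) :
    mFourierCoeff (fun x : UnitAddTorus d => ∫ u in (-h)..h, v (x + Pi.single i ((u : ℝ) : UnitAddCircle))) k =
      ((2 * h * Real.sinc (2 * Real.pi * (k i) * h) : ℝ) : ℂ) • mFourierCoeff v k := by
  rw [mFourierCoeff_eq_integral_volume]
  -- the joint integrand
  set f : ℝ → UnitAddTorus d → ℂ := fun u x => mFourier (-k) x • v (x + Pi.single i ((u : ℝ) : UnitAddCircle)) with hf
  have hcoe : Continuous fun u : ℝ => ((u : ℝ) : UnitAddCircle) := AddCircle.continuous_mk' (1 : ℝ)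
  have hcont : Continuous (uncurry f) := by
    refine Continuous.smul ((mFourier (-k)).continuous.comp continuous_snd) (hv.comp ?_)
    exact continuous_snd.add ((continuous_single i).comp (hcoe.comp continuous_fst))
  obtain ⟨C, hC⟩ := (isCompact_univ (X := UnitAddTorus d)).exists_bound_of_continuousOn hv.continuousOn
  have hbound : ∀ p : ℝ × UnitAddTorus d, ‖uncurry f p‖ ≤ C := by
    rintro ⟨u, x⟩
    simp only [uncurry, hf, norm_smul]
    calc ‖mFourier (-k) x‖ * ‖v (x + Pi.single i ((u : ℝ) : UnitAddCircle))‖ ≤ 1 * C :=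
          mul_le_mul (((mFourier (-k)).norm_coe_le_norm x).trans_eq mFourier_norm) (hC _ (mem_univ _))
            (norm_nonneg _) zero_le_one
      _ = C := one_mul C
  have hint : Integrable (uncurry f) ((volume.restrict (Set.uIoc (-h) h)).prod (volume : Measure (UnitAddTorus d))) := by
    rw [Set.uIoc_of_le (by linarith : -h ≤ h)]
    exact (integrable_const C).mono' hcont.aestronglyMeasurable (ae_of_all _ hbound)
  -- move the character inside and swap
  have h1 : (fun x : UnitAddTorus d => mFourier (-k) x • ∫ u in (-h)..h, v (x + Pi.single i ((u : ℝ) : UnitAddCircle))) =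
      fun x => ∫ u in (-h)..h, f u x := by
    funext x
    rw [hf]
    exact (intervalIntegral.integral_smul _ _).symm
  rw [h1, ← intervalIntegral_integral_swap hint]
  -- the inner integrals are the coefficients of the translates
  have h2 : ∀ u : ℝ, ∫ x, f u x = (fourier (k i) ((u : ℝ) : UnitAddCircle) : ℂ) • mFourierCoeff v k := by
    intro u
    rw [hf, ← mFourierCoeff_comp_add_single v k i ((u : ℝ) : UnitAddCircle), mFourierCoeff_eq_integral_volume]
  simp_rw [h2]
  rw [intervalIntegral.integral_smul_const, intervalIntegral_fourier_coe (k i) hh]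

/-! ## §3 Strip energy versus windowed averages -/

/-- **Strip energy is controlled by the windowed axis average**: for continuous `v` and `L > 0`, with `h = 1/(4L)`,
`Σ' k, [|kᵢ| ≤ L]·‖𝓕v(k)‖² ≤ (πL)²·∫ ‖∫_{−h}^{h} v(x + ueᵢ) du‖² dx` (multiplier `≥ 1/(πL)` on the strip, Parseval).
[cite: Grafakos2014, Prop. 3.2.7 (3)] -/
theorem tsum_strip_le_windowAvg {v : UnitAddTorus d → ℂ} (hv : Continuous v) (i : d) {L : ℝ} (hL : 0 < L) :
    ∑' k : d → ℤ, (if |((k i : ℤ) : ℝ)| ≤ L then (1 : ℝ) else 0) * ‖mFourierCoeff v k‖ ^ 2 ≤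
      (Real.pi * L) ^ 2 * ∫ x : UnitAddTorus d,
        ‖∫ u in (-(1 / (4 * L)))..(1 / (4 * L)), v (x + Pi.single i ((u : ℝ) : UnitAddCircle))‖ ^ 2 := by
  have hh : 0 < 1 / (4 * L) := by positivity
  set W : UnitAddTorus d → ℂ :=
    fun x => ∫ u in (-(1 / (4 * L)))..(1 / (4 * L)), v (x + Pi.single i ((u : ℝ) : UnitAddCircle)) with hWdef
  have hWc : Continuous W := continuous_windowAvg hv i _ _
  have hW := hasSum_sq_mFourierCoeff_of_continuous hWc
  -- the multiplier on each mode
  set μ : (d → ℤ) → ℝ := fun k => 2 * (1 / (4 * L)) * Real.sinc (2 * Real.pi * (k i : ℝ) * (1 / (4 * L))) with hμdef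
  have hWk : ∀ k : d → ℤ, ‖mFourierCoeff W k‖ ^ 2 = μ k ^ 2 * ‖mFourierCoeff v k‖ ^ 2 := by
    intro k
    have hk := mFourierCoeff_windowAvg hv i hh k
    rw [← hWdef] at hk
    rw [hk, norm_smul, mul_pow, Complex.norm_real, Real.norm_eq_abs, sq_abs]
  -- on the strip the multiplier is at least `1/(πL)`
  have hμ : ∀ k : d → ℤ, |((k i : ℤ) : ℝ)| ≤ L → 1 ≤ (Real.pi * L) ^ 2 * μ k ^ 2 := by
    intro k hk
    have hα : |2 * Real.pi * (k i : ℝ) * (1 / (4 * L))| ≤ Real.pi / 2 := by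
      have e : 2 * Real.pi * (k i : ℝ) * (1 / (4 * L)) = Real.pi / (2 * L) * (k i : ℝ) := by
        field_simp; ring
      rw [e, abs_mul, abs_of_pos (by positivity : (0 : ℝ) < Real.pi / (2 * L))]
      calc Real.pi / (2 * L) * |(k i : ℝ)| ≤ Real.pi / (2 * L) * L :=
            mul_le_mul_of_nonneg_left hk (by positivity)
        _ = Real.pi / 2 := by field_simp
    have hs := two_div_pi_le_sinc hα
    have h1 : 1 ≤ Real.pi * L * μ k := by
      have e : Real.pi * L * μ k = (Real.pi / 2) * Real.sinc (2 * Real.pi * (k i : ℝ) * (1 / (4 * L))) := by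
        rw [hμdef]; field_simp; ring
      rw [e]
      calc (1 : ℝ) = (Real.pi / 2) * (2 / Real.pi) := by field_simp
        _ ≤ (Real.pi / 2) * Real.sinc (2 * Real.pi * (k i : ℝ) * (1 / (4 * L))) :=
            mul_le_mul_of_nonneg_left hs (by positivity)
    calc (1 : ℝ) ≤ (Real.pi * L * μ k) ^ 2 := by nlinarith
      _ = (Real.pi * L) ^ 2 * μ k ^ 2 := by ring
  -- termwise comparison and summation
  have hle : ∀ k : d → ℤ, (if |((k i : ℤ) : ℝ)| ≤ L then (1 : ℝ) else 0) * ‖mFourierCoeff v k‖ ^ 2 ≤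
      (Real.pi * L) ^ 2 * ‖mFourierCoeff W k‖ ^ 2 := by
    intro k
    rw [hWk k]
    split_ifs with hk
    · calc (1 : ℝ) * ‖mFourierCoeff v k‖ ^ 2 ≤ ((Real.pi * L) ^ 2 * μ k ^ 2) * ‖mFourierCoeff v k‖ ^ 2 :=
            mul_le_mul_of_nonneg_right (hμ k hk) (sq_nonneg _)
        _ = _ := by ring
    · rw [zero_mul]; positivity
  have hsum2 : Summable fun k : d → ℤ => (Real.pi * L) ^ 2 * ‖mFourierCoeff W k‖ ^ 2 := hW.summable.mul_left _
  have hnn : ∀ k : d → ℤ, 0 ≤ (if |((k i : ℤ) : ℝ)| ≤ L then (1 : ℝ) else 0) * ‖mFourierCoeff v k‖ ^ 2 :=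
    fun k => mul_nonneg (by split_ifs <;> norm_num) (sq_nonneg _)
  have hsum1 : Summable fun k : d → ℤ => (if |((k i : ℤ) : ℝ)| ≤ L then (1 : ℝ) else 0) * ‖mFourierCoeff v k‖ ^ 2 :=
    Summable.of_nonneg_of_le hnn hle hsum2
  calc ∑' k : d → ℤ, (if |((k i : ℤ) : ℝ)| ≤ L then (1 : ℝ) else 0) * ‖mFourierCoeff v k‖ ^ 2
      ≤ ∑' k : d → ℤ, (Real.pi * L) ^ 2 * ‖mFourierCoeff W k‖ ^ 2 := Summable.tsum_le_tsum hle hsum1 hsum2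
    _ = (Real.pi * L) ^ 2 * ∫ x : UnitAddTorus d, ‖W x‖ ^ 2 := by rw [tsum_mul_left, hW.tsum_eq]

/-- **Weighted form**: for a weight `0 ≤ w ≤ [|kᵢ| ≤ L]` (e.g. the square of the ledger's radial start symbol on the strip),
`Σ' k, w(k)·‖𝓕v(k)‖² ≤ (πL)²·∫ ‖∫_{−h}^{h} v(x + ueᵢ) du‖² dx`, `h = 1/(4L)`. [cite: Grafakos2014, Prop. 3.2.7 (3)] -/
theorem tsum_weight_le_windowAvg {v : UnitAddTorus d → ℂ} (hv : Continuous v) (i : d) {L : ℝ} (hL : 0 < L)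
    {w : (d → ℤ) → ℝ} (hw0 : ∀ k, 0 ≤ w k) (hw1 : ∀ k, w k ≤ 1) (hwL : ∀ k, L < |((k i : ℤ) : ℝ)| → w k = 0) :
    ∑' k : d → ℤ, w k * ‖mFourierCoeff v k‖ ^ 2 ≤
      (Real.pi * L) ^ 2 * ∫ x : UnitAddTorus d,
        ‖∫ u in (-(1 / (4 * L)))..(1 / (4 * L)), v (x + Pi.single i ((u : ℝ) : UnitAddCircle))‖ ^ 2 := by
  have hle : ∀ k : d → ℤ, w k * ‖mFourierCoeff v k‖ ^ 2 ≤
      (if |((k i : ℤ) : ℝ)| ≤ L then (1 : ℝ) else 0) * ‖mFourierCoeff v k‖ ^ 2 := by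
    intro k
    refine mul_le_mul_of_nonneg_right ?_ (sq_nonneg _)
    split_ifs with hk
    · exact hw1 k
    · exact (hwL k (not_le.mp hk)).le
  have hsumI : Summable fun k : d → ℤ => (if |((k i : ℤ) : ℝ)| ≤ L then (1 : ℝ) else 0) * ‖mFourierCoeff v k‖ ^ 2 := by
    refine Summable.of_nonneg_of_le (fun k => by positivity) (fun k => ?_) (hasSum_sq_mFourierCoeff_of_continuous hv).summable
    split_ifs <;> simp
  have hsumw : Summable fun k : d → ℤ => w k * ‖mFourierCoeff v k‖ ^ 2 :=
    Summable.of_nonneg_of_le (fun k => mul_nonneg (hw0 k) (sq_nonneg _)) hle hsumI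
  exact (Summable.tsum_le_tsum hle hsumw hsumI).trans (tsum_strip_le_windowAvg hv i hL)

/-! ## §4 Real scalars and pointwise majorants -/

/-- **Real scalars**: `Σ' k, [|kᵢ| ≤ L]·‖𝓕θ(k)‖² ≤ (πL)²·∫ (∫_{−h}^{h} θ(x + ueᵢ) du)² dx`, `h = 1/(4L)`.
[cite: Grafakos2014, Prop. 3.2.7 (3)] -/
theorem tsum_strip_real_le_windowAvg {θ : UnitAddTorus d → ℝ} (hθ : Continuous θ) (i : d) {L : ℝ} (hL : 0 < L) :
    ∑' k : d → ℤ, (if |((k i : ℤ) : ℝ)| ≤ L then (1 : ℝ) else 0) * ‖mFourierCoeff (fun x => (θ x : ℂ)) k‖ ^ 2 ≤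
      (Real.pi * L) ^ 2 * ∫ x : UnitAddTorus d,
        (∫ u in (-(1 / (4 * L)))..(1 / (4 * L)), θ (x + Pi.single i ((u : ℝ) : UnitAddCircle))) ^ 2 := by
  have hθc : Continuous (fun x => (θ x : ℂ)) := Complex.continuous_ofReal.comp hθ
  have h := tsum_strip_le_windowAvg hθc i hL
  have e : ∀ x : UnitAddTorus d, ‖∫ u in (-(1 / (4 * L)))..(1 / (4 * L)),
      ((θ (x + Pi.single i ((u : ℝ) : UnitAddCircle)) : ℝ) : ℂ)‖ ^ 2 =
      (∫ u in (-(1 / (4 * L)))..(1 / (4 * L)), θ (x + Pi.single i ((u : ℝ) : UnitAddCircle))) ^ 2 := by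
    intro x
    rw [intervalIntegral.integral_ofReal, Complex.norm_real, Real.norm_eq_abs, sq_abs]
  simp_rw [e] at h
  exact h

/-- **Strip energy from a pointwise majorant of the windowed averages**: if `|∫_{−h}^{h} θ(x + ueᵢ) du| ≤ g(x)` for all `x`
(`g` continuous, `h = 1/(4L)`), then `Σ' k, [|kᵢ| ≤ L]·‖𝓕θ(k)‖² ≤ (πL)²·∫ g²`. [cite: Grafakos2014, Prop. 3.2.7 (3)] -/
theorem tsum_strip_real_le_of_windowAvg_le {θ : UnitAddTorus d → ℝ} (hθ : Continuous θ) (i : d) {L : ℝ} (hL : 0 < L)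
    {g : UnitAddTorus d → ℝ} (hg : Continuous g)
    (hle : ∀ x, |∫ u in (-(1 / (4 * L)))..(1 / (4 * L)), θ (x + Pi.single i ((u : ℝ) : UnitAddCircle))| ≤ g x) :
    ∑' k : d → ℤ, (if |((k i : ℤ) : ℝ)| ≤ L then (1 : ℝ) else 0) * ‖mFourierCoeff (fun x => (θ x : ℂ)) k‖ ^ 2 ≤
      (Real.pi * L) ^ 2 * ∫ x, g x ^ 2 := by
  refine (tsum_strip_real_le_windowAvg hθ i hL).trans (mul_le_mul_of_nonneg_left ?_ (sq_nonneg _))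
  refine integral_mono_of_nonneg (Eventually.of_forall fun x => sq_nonneg _) ((hg.pow 2).integrable_unitAddTorus)
    (Eventually.of_forall fun x => ?_)
  have h := hle x
  show (∫ u in (-(1 / (4 * L)))..(1 / (4 * L)), θ (x + Pi.single i ((u : ℝ) : UnitAddCircle))) ^ 2 ≤ g x ^ 2
  rw [← sq_abs]
  exact pow_le_pow_left₀ (abs_nonneg _) h 2

/-- **Weighted real form** (the ledger's start symbol on the strip): for `0 ≤ w ≤ [|kᵢ| ≤ L]` and a continuous majorant `g`
of `|∫_{−h}^{h} θ(x + ueᵢ) du|`, `Σ' k, w(k)·‖𝓕θ(k)‖² ≤ (πL)²·∫ g²`. [cite: Grafakos2014, Prop. 3.2.7 (3)] -/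
theorem tsum_weight_real_le_of_windowAvg_le {θ : UnitAddTorus d → ℝ} (hθ : Continuous θ) (i : d) {L : ℝ}
    (hL : 0 < L) {w : (d → ℤ) → ℝ} (hw0 : ∀ k, 0 ≤ w k) (hw1 : ∀ k, w k ≤ 1)
    (hwL : ∀ k, L < |((k i : ℤ) : ℝ)| → w k = 0) {g : UnitAddTorus d → ℝ} (hg : Continuous g)
    (hle : ∀ x, |∫ u in (-(1 / (4 * L)))..(1 / (4 * L)), θ (x + Pi.single i ((u : ℝ) : UnitAddCircle))| ≤ g x) :
    ∑' k : d → ℤ, w k * ‖mFourierCoeff (fun x => (θ x : ℂ)) k‖ ^ 2 ≤ (Real.pi * L) ^ 2 * ∫ x, g x ^ 2 := by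
  have hθc : Continuous (fun x => (θ x : ℂ)) := Complex.continuous_ofReal.comp hθ
  have hleI : ∀ k : d → ℤ, w k * ‖mFourierCoeff (fun x => (θ x : ℂ)) k‖ ^ 2 ≤
      (if |((k i : ℤ) : ℝ)| ≤ L then (1 : ℝ) else 0) * ‖mFourierCoeff (fun x => (θ x : ℂ)) k‖ ^ 2 := by
    intro k
    refine mul_le_mul_of_nonneg_right ?_ (sq_nonneg _)
    split_ifs with hk
    · exact hw1 k
    · exact (hwL k (not_le.mp hk)).le
  have hsumI : Summable fun k : d → ℤ =>
      (if |((k i : ℤ) : ℝ)| ≤ L then (1 : ℝ) else 0) * ‖mFourierCoeff (fun x => (θ x : ℂ)) k‖ ^ 2 := by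
    refine Summable.of_nonneg_of_le (fun k => by positivity) (fun k => ?_)
      (hasSum_sq_mFourierCoeff_of_continuous hθc).summable
    split_ifs <;> simp
  have hsumw : Summable fun k : d → ℤ => w k * ‖mFourierCoeff (fun x => (θ x : ℂ)) k‖ ^ 2 :=
    Summable.of_nonneg_of_le (fun k => mul_nonneg (hw0 k) (sq_nonneg _)) hleI hsumI
  exact (Summable.tsum_le_tsum hleI hsumw hsumI).trans (tsum_strip_real_le_of_windowAvg_le hθ i hL hg hle)

end Summit.AnomalousDissipation.AnomalousDissipation.Theorems.SawtoothPulseCascade.K1Start
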